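import Summits.CriticalPhenomena.PercolationContinuityZ3.Theorems.PercNearOneGluingNoHeavyLowerTailKNConjecturesOfS5
import Summits.CriticalPhenomena.PercolationContinuityZ3.Theorems.PercNearOneGluingNoHeavyLowerTailCSHTheoremOne
import HarnessLib

/-!
# Kozma–Nitzan's Conjecture 1, for every relay set, unconditionally

Support file (`--supports stmt-CriticalPhenomena-4575`), prover `prim-ineq-gen-6` (gen 8).  No definitions, no named facts, no sorries.

The registered conjecture `Literature.StrongHypotheses.CriticalPhenomena.KozmaNitzan2024_conjecture1` (arXiv:2401.12397, p. 3:
`P(0 ↔ b) ≥ P(0 ↔ A)·min_a P(a ↔ b)` on every finite weighted graph) is discharged: this seat's reduction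
`kozmaNitzan2024_conjecture1_of_s5dMargin_nondegenerate` (Conjecture 1 ⟸ (GEN) ⟸ (S5) ⟸ the decoy-free (S5D) margin), prim-hp-8's
`CSH.s5dMargin_nonneg_of_csh` ((S5D) ⟸ CSH) and prim-ineq-prove-1's `CSH.cshAll` (the conditioned slack hierarchy, prim-hp-8's Theorem 1).
[cite: KozmaNitzan2024, Conj. 1 (p. 3), Conj. 4 (p. 32)]
-/

noncomputable section

namespace Summit.CriticalPhenomena.PercolationContinuityZ3.Theorems

open MeasureTheory Set Literature.Probability.LatticeModels Literature.Probability.Percolation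
open scoped Classical

/-- **KOZMA–NITZAN'S CONJECTURE 1, unconditionally**: on every finite weighted graph, for every relay set `A` and all `0, b`,
`P(0 ↔ A)·t ≤ P(0 ↔ b)` whenever `t ≤ P(a ↔ b)` for all `a ∈ A`. [cite: KozmaNitzan2024, Conj. 1 (p. 3)] -/
theorem kozmaNitzan2024_conjecture1_holds : Literature.StrongHypotheses.CriticalPhenomena.KozmaNitzan2024_conjecture1 :=
  kozmaNitzan2024_conjecture1_of_s5dMargin_nondegenerate fun n p hp T o v F r hoT hvT hov hF _ hr hcompat =>
    CSH.s5dMargin_nonneg_of_csh p hp o v (fun x Y D => CSH.cshAll n p hp o v x Y D hov) T r [] F hF hr hcompat hoT hvT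
      List.nodup_nil (fun _ hd => absurd hd List.not_mem_nil)

end Summit.CriticalPhenomena.PercolationContinuityZ3.Theorems

end
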